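import Summits.Ventures.PercRepro.S1SeriesLeverPlane
import Summits.Ventures.PercRepro.S1Lever

/-!
# PercRepro — THE TRIANGLE LEVER WITH EXACT POINT COUNTS (p2, gen 26; SUBCLAIM-S1 §6.10)

The triangle lever of S1Lever (`s₃ ≤ ⌊n·cq3 (d − 1)/(n − 3)⌋`) takes ONE averaging step and then the table. Iterated
with exact point counts it is much stronger, because a point `x` of minimum triangle-degree splits into three cases:
`x` on no triangle (then `s₃ ≤ cq3 (ν − 1)` on the coloop-free part of `M ＼ x`), `x` on a triangle with no series
partner (`M ＼ x` is coloop-free on `n − 1` points: `s₃ − ⌊3 s₃/n⌋ ≤ triT (ν − 1) (n − 1)`), or `x` on a triangle with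
`k ∈ {1, 2}` series partners — they lie on every circuit through `x` (p7's lemma), so on `x`'s triangle, and the
line through `x` and a partner carries every triangle through `x`: `deg x = 1`, and the coloop-free part of `M ＼ x` has
`n − 1 − k` points. `triT 10 19 = 16`: a coloop-free `e`-free core of rank `9` on `19` points has at most `16`
triangles (the landed lever said `19`), so the cap (P9,10) of the cell `(9, 10)`, needed at `t ≥ 18` only, is
vacuous — THE CELL `(9, 10)` CLOSES (S1CellNineTen).

* `triT` — the recursion; `triT_values`;
* `triangles_delete_coloops`, `ncard_trianglesThrough_le_one_of_isColoop_delete` — the pieces;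
* **`ncard_triangles_le_triT`** — `s₃ ≤ triT ν n` on every coloop-free `e`-free core of nullity `ν` on `n` points.
Axioms: standard.
-/

open scoped Matroid

namespace PercRepro

namespace S1

open Set

variable {α : Type}

/-- **THE TRIANGLE LEVER WITH EXACT POINT COUNTS**: `triT ν n` bounds `s₃` on every coloop-free `e`-free core of
nullity `ν` on `n` points — `cq3 ν` at `ν ≤ 4` or `n < 9`, else the least of `cq3 ν` and the largest of
`cq3 (ν − 1)` (a point on no triangle), `⌊n·triT (ν − 1) (n − 1)/(n − 3)⌋` (the averaged point, no series partner),
`1 + triT (ν − 1) (n − 2)` and `1 + triT (ν − 1) (n − 3)` (one, resp. two, series partners). -/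
def triT : ℕ → ℕ → ℕ
  | 0, _ => TriangleCap.cq3 0
  | 1, _ => TriangleCap.cq3 1
  | 2, _ => TriangleCap.cq3 2
  | 3, _ => TriangleCap.cq3 3
  | 4, _ => TriangleCap.cq3 4
  | d + 5, n => if n < 9 then TriangleCap.cq3 (d + 5) else
      min (TriangleCap.cq3 (d + 5))
        (max (max (TriangleCap.cq3 (d + 4)) (n * triT (d + 4) (n - 1) / (n - 3)))
          (max (1 + triT (d + 4) (n - 2)) (1 + triT (d + 4) (n - 3))))

/-- `triT d n = cq3 d` for `d ≤ 4`. -/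
theorem triT_of_le_four {d : ℕ} (hd : d ≤ 4) (n : ℕ) : triT d n = TriangleCap.cq3 d := by
  interval_cases d <;> rfl

/-- The unfolding of `triT` at nullity `d + 5`. -/
theorem triT_succ (d n : ℕ) : triT (d + 5) n = (if n < 9 then TriangleCap.cq3 (d + 5) else
    min (TriangleCap.cq3 (d + 5))
      (max (max (TriangleCap.cq3 (d + 4)) (n * triT (d + 4) (n - 1) / (n - 3)))
        (max (1 + triT (d + 4) (n - 2)) (1 + triT (d + 4) (n - 3))))) := rfl

/-- The values on the row-9 cores: `triT 10 19 = 16`, `triT 9 18 = 14`, `triT 8 17 = 12`, `triT 8 16 = 12`. -/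
theorem triT_values : triT 10 19 = 16 ∧ triT 9 18 = 14 ∧ triT 8 17 = 12 ∧ triT 8 16 = 12 := by
  decide

/-- The triangles of the coloop-free part are those of `M` (a coloop is on no circuit). -/
theorem triangles_delete_coloops (M : Matroid α) :
    {C : Set α | (M ＼ M.coloops).IsCircuit C ∧ C.ncard = 3} = {C : Set α | M.IsCircuit C ∧ C.ncard = 3} := by
  ext C
  simp only [mem_setOf_eq, Matroid.delete_isCircuit_iff]
  constructor
  · rintro ⟨⟨hC, -⟩, h3⟩; exact ⟨hC, h3⟩
  · rintro ⟨hC, h3⟩; exact ⟨⟨hC, hC.disjoint_coloops⟩, h3⟩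

/-- **A point with a series partner lies on at most one triangle**: on a coloop-free `e`-free `M`, if `a` is a
coloop of `M ＼ x`, every triangle through `x` is `{x, a, c}` with `c ∈ cl{x, a}`, a line of `≤ 3` points. -/
theorem ncard_trianglesThrough_le_one_of_isColoop_delete (M : Matroid α) [M.Finite]
    (hfree : ∀ e ∈ M.E, ∃ A ⊆ M.E \ {e}, e ∉ M.closure A ∧ e ∉ M.closure ((M.E \ {e}) \ A))
    (hcol : M.coloops = ∅) {x a : α} (hxE : x ∈ M.E) (ha : (M ＼ {x}).IsColoop a) :
    (ThmN.trianglesThrough M x).ncard ≤ 1 := by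
  classical
  have haE : a ∈ M.E := ((M ＼ {x}).coloops_subset_ground ha).1
  have hax : a ≠ x := by
    intro h
    have := (M ＼ {x}).coloops_subset_ground ha
    rw [h] at this
    exact this.2 (Set.mem_singleton x)
  have hac : ¬ M.IsColoop a := by
    rw [Matroid.isColoop_iff_mem_coloops, hcol]; exact Set.notMem_empty a
  set I : Set α := {x, a} with hI
  have hIE : I ⊆ M.E := Set.pair_subset hxE haE
  have hIfin : I.Finite := Set.toFinite _
  have hIcard : I.ncard = 2 := Set.ncard_pair hax.symm
  -- the line `cl I` has `≤ 3` points
  have hclE : M.closure I ⊆ M.E := M.closure_subset_ground I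
  have hr2 : M.eRk I = 2 := by
    have hL : ∀ e ∈ M.E, ¬ M.IsLoop e := ThmN.not_isLoop_of_free M hfree
    have h2 : (2 : ℕ∞) ≤ M.eRk I :=
      ThmN.two_le_eRk_of_two_le_ncard_of_free M hfree hIE (by rw [hIcard])
    have h3 : M.eRk I ≤ 2 := by
      have := M.eRk_le_encard I
      rwa [← hIfin.cast_ncard_eq, hIcard] at this
    exact le_antisymm h3 h2
  have hcl3 : (M.closure I).ncard ≤ 3 := by
    have hL : ∀ e ∈ M.E, ¬ M.IsLoop e := ThmN.not_isLoop_of_free M hfree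
    have := ThmN.ncard_add_one_le_two_pow_of_eRk_le M hL hfree 2 (M.closure I) hclE (by rw [M.eRk_closure_eq, hr2]; simp)
    omega
  have hIcl : I ⊆ M.closure I := M.subset_closure I hIE
  set T := M.closure I \ I with hT
  have hTfin : T.Finite := (M.ground_finite.subset hclE).subset Set.sdiff_subset
  have hTcard : T.ncard ≤ 1 := by
    rw [hT, Set.ncard_sdiff hIcl hIfin, hIcard]
    omega
  -- every triangle through `x` contains `a`
  have hsubC : ∀ C ∈ ThmN.trianglesThrough M x, I ⊆ C := by
    intro C hC
    obtain ⟨hC, -, hxC⟩ := hC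
    have haC : a ∈ C := S2.mem_of_isColoop_delete_of_mem_isCircuit M hac ha hC hxC
    exact Set.pair_subset hxC haC
  refine (Set.ncard_le_ncard_of_injOn (t := (fun w : α => ({w} : Set α)) '' T) (fun C => C \ I) ?_ ?_
    (hTfin.image _)).trans ?_
  · intro C hC
    have hsub := hsubC C hC
    obtain ⟨hC', h3, -⟩ := hC
    have h1 : (C \ I).ncard = 1 := by
      rw [Set.ncard_sdiff hsub hIfin, h3, hIcard]
    obtain ⟨w, hw⟩ := Set.ncard_eq_one.1 h1
    refine ⟨w, ?_, hw.symm⟩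
    have hwC : w ∈ C \ I := by rw [hw]; exact Set.mem_singleton w
    have hCw : C \ {w} = I := by
      have hCeq : C = I ∪ (C \ I) := (Set.union_sdiff_cancel hsub).symm
      rw [hw] at hCeq
      rw [hCeq, Set.union_singleton, Set.insert_sdiff_of_mem _ (Set.mem_singleton w),
        Set.sdiff_singleton_eq_self hwC.2]
    have hwcl : w ∈ M.closure I := by
      have := hC'.mem_closure_sdiff_singleton_of_mem hwC.1
      rwa [hCw] at this
    exact ⟨hwcl, hwC.2⟩
  · intro C hC C' hC' heq
    have hsub := hsubC C hC
    have hsub' := hsubC C' hC'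
    simp only at heq
    calc C = I ∪ (C \ I) := (Set.union_sdiff_cancel hsub).symm
      _ = I ∪ (C' \ I) := by rw [heq]
      _ = C' := Set.union_sdiff_cancel hsub'
  · rw [Set.ncard_image_of_injective _ Set.singleton_injective]
    exact hTcard

/-- **`s₃ ≤ triT ν n` on every coloop-free `e`-free core of nullity `ν` on `n` points.** -/
theorem ncard_triangles_le_triT (ν : ℕ) : ∀ (M : Matroid α) [M.Finite],
    (∀ e ∈ M.E, ∃ A ⊆ M.E \ {e}, e ∉ M.closure A ∧ e ∉ M.closure ((M.E \ {e}) \ A)) →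
    M.E.encard = M.eRank + ν → M.coloops = ∅ →
    {C : Set α | M.IsCircuit C ∧ C.ncard = 3}.ncard ≤ triT ν M.E.ncard := by
  induction ν with
  | zero =>
    intro M _ hfree hd _
    rw [triT_of_le_four (by norm_num)]
    exact TriangleCap.core_ncard_triangles_le_cq3 M hfree hd
  | succ d ih =>
    intro M _ hfree hd hcol
    rcases Nat.lt_or_ge d 4 with hd4 | hd4
    · rw [triT_of_le_four (by omega)]
      exact TriangleCap.core_ncard_triangles_le_cq3 M hfree hd
    obtain ⟨d', rfl⟩ : ∃ d', d = d' + 4 := ⟨d - 4, by omega⟩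
    rw [show d' + 4 + 1 = d' + 5 by ring] at hd ⊢
    rw [triT_succ]
    split_ifs with hn9
    · exact TriangleCap.core_ncard_triangles_le_cq3 M hfree hd
    classical
    refine le_min (TriangleCap.core_ncard_triangles_le_cq3 M hfree hd) ?_
    set n := M.E.ncard with hn
    have hn9' : 9 ≤ n := by omega
    have hL : ∀ e ∈ M.E, ¬ M.IsLoop e := ThmN.not_isLoop_of_free M hfree
    have hC1 : ∀ L ⊆ M.E, M.eRk L = 2 → L.ncard ≤ 3 := by
      intro L hL' hr
      have := ThmN.ncard_add_one_le_two_pow_of_eRk_le M hL hfree 2 L hL' hr.le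
      omega
    have hC2 : ∀ P ⊆ M.E, M.eRk P ≤ 3 → P.ncard ≤ 6 := fun P hP hr =>
      ThmN.ncard_le_six_of_eRk_le_three_of_free M hfree hP hr
    have hd' : M.E.encard = M.eRank + ((d' + 4 + 1 : ℕ) : ℕ∞) := by rw [hd]
    change (ThmN.triangles M).ncard ≤ _
    rcases Nat.eq_zero_or_pos (ThmN.triangles M).ncard with h0 | hpos
    · rw [h0]; exact Nat.zero_le _
    -- a point of degree `≤ ⌊3·s₃/n⌋`
    obtain ⟨x, hxE, hx⟩ : ∃ x ∈ M.E,
        (ThmN.trianglesThrough M x).ncard ≤ 3 * (ThmN.triangles M).ncard / M.E.ncard := by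
      by_contra hno
      have hall : ∀ x ∈ M.E,
          3 * (ThmN.triangles M).ncard / M.E.ncard + 1 ≤ (ThmN.trianglesThrough M x).ncard := by
        intro x hx
        by_contra h
        exact hno ⟨x, hx, by omega⟩
      have h1 := mul_ncard_ground_le_three_mul_ncard_triangles M
        (3 * (ThmN.triangles M).ncard / M.E.ncard + 1) hall
      have h2 : 3 * (ThmN.triangles M).ncard <
          (3 * (ThmN.triangles M).ncard / M.E.ncard + 1) * M.E.ncard :=
        Nat.lt_mul_of_div_lt (Nat.lt_succ_self _) (by omega)
      omega
    have hne : ¬ M.IsColoop x := by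
      rw [Matroid.isColoop_iff_mem_coloops, hcol]
      exact Set.notMem_empty x
    obtain ⟨hdx, -, -, hle⟩ := ncard_triangles_le_add_of_not_isColoop M hC1 hC2 (d := d' + 4) hd' hxE hne
    rw [← hn] at hx
    -- the coloop-free part `Q` of `M ＼ x`
    set K := (M ＼ {x}).coloops with hK
    set Q := (M ＼ {x}) ＼ K with hQ
    have hKsub : K ⊆ (M ＼ {x}).E := (M ＼ {x}).coloops_subset_ground
    have hKfin : K.Finite := (M ＼ {x}).ground_finite.subset hKsub
    have hxn : (M ＼ {x}).E.ncard + 1 = n := by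
      rw [_root_.Matroid.delete_ground]
      exact Set.ncard_sdiff_singleton_add_one hxE M.ground_finite
    have hQn : Q.E.ncard = n - 1 - K.ncard := by
      rw [hQ, ncard_ground_delete_coloops, Set.ncard_sdiff hKsub hKfin]
      omega
    have hQfree := hfree_delete_set (M ＼ {x}) (hfree_delete M hfree x) K
    have hQcol : Q.coloops = ∅ := coloops_delete_coloops (M ＼ {x})
    have hQd : Q.E.encard = Q.eRank + ((d' + 4 : ℕ) : ℕ∞) := encard_delete_coloops (M ＼ {x}) hdx
    have hQtri : {C : Set α | Q.IsCircuit C ∧ C.ncard = 3} = ThmN.triangles (M ＼ {x}) :=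
      triangles_delete_coloops (M ＼ {x})
    have hrec := ih Q hQfree hQd hQcol
    rw [hQtri, hQn] at hrec
    rcases Nat.eq_zero_or_pos (ThmN.trianglesThrough M x).ncard with hdeg0 | hdegpos
    · -- `x` on no triangle: the table at nullity `d' + 4`
      have h1 : (ThmN.triangles (M ＼ {x})).ncard ≤ TriangleCap.cq3 (d' + 4) :=
        TriangleCap.core_ncard_triangles_le_cq3 (M ＼ {x}) (hfree_delete M hfree x) hdx
      exact le_max_of_le_left (le_max_of_le_left (by omega))
    · -- `x` on a triangle `T`: every coloop of `M ＼ x` lies on `T`, so `k ≤ 2`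
      obtain ⟨T, hT⟩ : ∃ T, T ∈ ThmN.trianglesThrough M x := by
        by_contra hno
        push Not at hno
        have : ThmN.trianglesThrough M x = ∅ := Set.eq_empty_of_forall_notMem hno
        rw [this, Set.ncard_empty] at hdegpos
        omega
      obtain ⟨hTc, hT3, hxT⟩ := hT
      have hKT : K ⊆ T \ {x} := by
        intro a ha
        have haE := hKsub ha
        have hac : ¬ M.IsColoop a := by
          rw [Matroid.isColoop_iff_mem_coloops, hcol]; exact Set.notMem_empty a
        refine ⟨S2.mem_of_isColoop_delete_of_mem_isCircuit M hac ha hTc hxT, ?_⟩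
        intro hax
        rw [Set.mem_singleton_iff] at hax
        rw [_root_.Matroid.delete_ground] at haE
        exact haE.2 (by rw [hax]; exact Set.mem_singleton x)
      have hTfin : T.Finite := M.ground_finite.subset hTc.subset_ground
      have hk2 : K.ncard ≤ 2 := by
        have h := Set.ncard_le_ncard hKT (hTfin.subset Set.sdiff_subset)
        rw [Set.ncard_sdiff_singleton_of_mem hxT, hT3] at h
        exact h
      rcases Nat.eq_zero_or_pos K.ncard with hk0 | hkpos
      · -- no series partner: the averaged point
        rw [hk0, Nat.sub_zero] at hrec
        have hsub : (ThmN.triangles M).ncard - 3 * (ThmN.triangles M).ncard / n ≤ triT (d' + 4) (n - 1) := by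
          omega
        exact le_max_of_le_left (le_max_of_le_right (le_mul_div_of_sub_div_le_three (by omega) hsub))
      · -- a series partner `a`: `x` lies on exactly one triangle
        obtain ⟨a, ha⟩ : ∃ a, a ∈ K := Set.nonempty_of_ncard_ne_zero (by omega)
        have hdeg1 := ncard_trianglesThrough_le_one_of_isColoop_delete M hfree hcol hxE ha
        rcases (show K.ncard = 1 ∨ K.ncard = 2 by omega) with hk1 | hk2'
        · rw [hk1, show n - 1 - 1 = n - 2 by omega] at hrec
          exact le_max_of_le_right (le_max_of_le_left (by omega))
        · rw [hk2', show n - 1 - 2 = n - 3 by omega] at hrec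
          exact le_max_of_le_right (le_max_of_le_right (by omega))

end S1

end PercRepro
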